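import Summits.RiemannHypothesis.RiemannHypothesis.Theorems.TiltedLandingLaw421R3DimpleSig
import Summits.RiemannHypothesis.RiemannHypothesis.Theorems.TiltedLandingLaw421StubAnalyticHeredity
import Summits.RiemannHypothesis.RiemannHypothesis.Theorems.TiltedLandingLaw421R3SuccTheft

/-! # TiltedLandingLaw421 — round 3q SUPPORT: COLUMN IMMUNITY (critic RESULT-20 (E1)) and the column door of `AntiEscape` (W-08, C1 rh-idea-5 g26)

SUPPORT module (no stub, no crux, no `sorry`). Nothing here bears on the truth of RH; RH is not proved.

(E1) of the critic's ESCAPE anatomy (RESULT-20, 2026-08-30T10:01:53Z), kernel-checked: on a legal frame every UPPER zero of `f^{(j)}` in the COLUMN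
`|Re u − x₀| ≤ R/2` is a level-`j` band state — the band inequality `(|Re u − x₀| − R/2)₊² + j·Im u² ≤ j·Hs²` only needs `Im u ≤ Hs`, which is strip
heredity (`stub_analyticHeredity`, landed). Hence an ESCAPE level (band_j ≠ ∅, band_{j+1} = ∅) needs the column EMPTY of upper zeros of `f^{(j+1)}`, and
`AntiEscape` follows from the COLUMN LAW `ColumnLawQ` («at a non-Ready′ level with a band state, `f^{(j+1)}` has an upper zero in the column») — a door on the
w₀-LINEAGE / column population rather than on the lowest state's own loot (critic RESULT-20 (i)).

* `abs_im_le_of_level` — strip heredity at level `j` from `EngineHyps5 2`.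
* ★ `stTrkDQ_of_column` — (E1): an upper zero of `f^{(j)}` (`f^{(j)} ≢ 0`) with `|Re u − x₀| ≤ R/2` is `StTrkDQ … j u`.
* `ColumnLawQ` (OPEN socket) and ★ `antiEscape_of_columnLaw : ColumnLawQ → AntiEscape`, `restSuccBotQ_of_columnLaw : ColumnLawQ → RestSuccBotQ`.
* §2 ★★ `column_successor_or_nlEvent_of_window` — the cluster step (#1032) with the all-in-band clause replaced by column immunity: a Jensen window
  around a band state with base INSIDE THE COLUMN gives a level-`(j+1)` band state or an NL event on the base; `ColumnWindow`,
  `readyR2_of_columnWindow_noSucc`, `windowCaseSig_columnWindow : WindowCaseSig ColumnWindow'`, and STUB 1 from the smaller residual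
  `restSuccBotQ_of_noColumnWindow : AntiEscapeG ColumnWindow' → RestSuccBotQ`; `AnyWindow` (either window), `windowCaseSig_anyWindow`,
  ★★ `restSuccBotQ_of_noAnyWindow : AntiEscapeG AnyWindow → RestSuccBotQ` and, with the tree's theft narrowing (`…R3SuccTheft`),
  ★★★ `restSuccBotQ_of_theft_noAnyWindow : AntiTheftG AnyWindow → RestSuccBotQ`.
* §2b SHADOW ENTRY: `jensenClear_vline`, `jensenClear_top`, ★★ `window_of_clear` / `columnWindow_of_clear` (two abscissae `α < Re v < β` outside every
  open shadow `(Re a − |Im a|, Re a + |Im a|)` of the non-real zeros of `f^{(j)}`, with `f^{(j)} f^{(j+1)} ≠ 0` there, give a Jensen window of height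
  `Hs + 1` — the top is clear by analytic heredity), ★★ `column_successor_or_nlEvent_of_clear` (the column step from shadow data alone).
* §2c PURE SHADOW form: `exists_real_ne_zero_near`, `exists_real_ne_zero_ne_zero` (identity theorem on the real axis), ★★★ `columnWindow_of_clearIntervals`
  (an open interval of clear abscissae on each side of `v` inside the column ⇒ `ColumnWindow`), `column_successor_or_ready_of_clearIntervals`; the
  zero-set predicates `ClearAt`, `ClearGaps`, `BandWindowOrClearGaps` with `windowCaseSig_clearGaps`, `windowCaseSig_bandWindowOrClearGaps` and
  ★★★ `restSuccBotQ_of_theft_noGaps : AntiTheftG BandWindowOrClearGaps → RestSuccBotQ` (theft-only + dirty-chain residual), `restSuccBotQ_of_noGaps`.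
* §3 (critic RESULT-21) `ColumnLawQ` DEMOTED (survives the 65-frame scan only via `¬window`; the lineage leaves the column sideways); the door of record
  is the LINEAGE LAW `LineageLawQ` (margin band `MarginBand`), with `stTrkDQ_of_marginBand`, `antiEscape_of_lineageLaw`, `restSuccBotQ_of_lineageLaw`.
* §4 THE COMBINED RESIDUAL `ResidualQ` (OPEN socket: lowest simple band state, not Ready′, no band window, no clear gaps, no dimple, column empty at
  level `j+1`, all critical points stolen by wing pairs ⇒ successor), `ColumnEmpty`, `thief_in_wing`, `AllStolenWing`, `allStolenWing_of_allStolen`,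
  `antiTheftG_of_residualQ`, ★★★ `restSuccBotQ_of_residualQ : ResidualQ → RestSuccBotQ`. -/

namespace RhW08.Column

open Complex Set
open scoped ComplexConjugate
open Literature.Analysis.Complex
open Summit.RiemannHypothesis.RiemannHypothesis.Theorems.Splittings.JensenWindow
open RhIdea6.G17.W07C7 RhIdea6.G17.W07C7.Rev6 RhIdea6.G18.W07C8.Law421BirthS RhIdea6.G19.W07C11.Seam
open RhIdea6.G20.W07C12.Frac RhIdea6.G20.W07C12.StColP RhW07.C12.FieldSplit RhIdea6.G21.W07C13.TentMax
open RhW07.C14.TwoSided RhW07.C14.Classes RhW07.C14.Lineage RhW07.C14.Booking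
open RhW07.C13.Heredity RhIdea6.G22.W07C15pre.Injection RhW07.E3.Cell RhW07.E3.Lit
open RhW08.Round1 RhW08.StSwap RhW08.Round2 RhW08.QuadW RhW08.SealSwapQ RhW08.SealSwap RhW08.SuccB RhW08.SuccSplit

/-- Strip heredity on a legal frame: every zero of a non-identically-zero `f^{(j)}` has `|Im| ≤ Hs`. -/
theorem abs_im_le_of_level {η : ℝ} {f : ℂ → ℂ} {x₀ s hmax R Hs : ℝ} {B : ℕ} (hE : EngineHyps5 2 η f x₀ s hmax R Hs B)
    {j : ℕ} (hnz : iteratedDeriv j f ≠ 0) {u : ℂ} (hu : iteratedDeriv j f u = 0) : |u.im| ≤ Hs := by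
  have hHs : 0 ≤ Hs := hE.2.2.2.2.2.2.2.1
  have hstrip : ∀ w : ℂ, f w = 0 → |w.im| ≤ Hs := hE.2.2.2.2.2.2.2.2.1
  have h0 : StubAnalyticHeredity.InClass f Hs := ⟨hE.1, hE.2.1, hE.2.2.1, hstrip⟩
  exact (_root_.stub_analyticHeredity f Hs j hHs h0 hnz).2.2.2 u hu

/-- ★ (E1) COLUMN IMMUNITY: an upper zero of `f^{(j)}` in the column `|Re u − x₀| ≤ R/2` is a level-`j` band state. -/
theorem stTrkDQ_of_column {η : ℝ} {f : ℂ → ℂ} {x₀ s hmax R Hs : ℝ} {B : ℕ} (hE : EngineHyps5 2 η f x₀ s hmax R Hs B)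
    {j : ℕ} (hnz : iteratedDeriv j f ≠ 0) {u : ℂ} (hu : iteratedDeriv j f u = 0) (hup : 0 < u.im) (hcol : |u.re - x₀| ≤ R / 2) :
    StTrkDQ η f x₀ s hmax R Hs B j u := by
  have him : u.im ≤ Hs := by
    have := abs_im_le_of_level hE hnz hu
    rwa [abs_of_pos hup] at this
  refine ⟨hnz, hu, hup, ?_, him⟩
  have hmax : max (|u.re - x₀| - R / 2) 0 = 0 := max_eq_right (by linarith)
  rw [hmax]
  have hj : (0 : ℝ) ≤ (j : ℝ) := by positivity
  have h2 : u.im ^ 2 ≤ Hs ^ 2 := pow_le_pow_left₀ hup.le him 2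
  nlinarith [mul_le_mul_of_nonneg_left h2 hj]

/-- The successor form: an upper zero of `f^{(j+1)}` in the column is a level-`(j+1)` band state as soon as `f^{(j)}` has a zero (so `f^{(j+1)} ≢ 0`). -/
theorem stTrkDQ_succ_of_column {η : ℝ} {f : ℂ → ℂ} {x₀ s hmax R Hs : ℝ} {B j : ℕ} {v u : ℂ} (hE : EngineHyps5 2 η f x₀ s hmax R Hs B)
    (hv : StTrkDQ η f x₀ s hmax R Hs B j v) (hu : iteratedDeriv (j + 1) f u = 0) (hup : 0 < u.im) (hcol : |u.re - x₀| ≤ R / 2) :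
    StTrkDQ η f x₀ s hmax R Hs B (j + 1) u :=
  stTrkDQ_of_column hE (iteratedDeriv_succ_ne_zero_of_zero hE.1 j hv.1 hv.2.1) hu hup hcol

/-- ★ COLUMN LAW (OPEN socket; critic RESULT-20 (E1)/(i)): on a legal frame, at a level `j` with a lowest band state that is not Ready′ (and, as in
`AntiEscape`, with no all-in-band in-range window and no dimple at it), `f^{(j+1)}` has an UPPER ZERO IN THE COLUMN `|Re u − x₀| ≤ R/2`.
DEMOTED by critic RESULT-21 (65-frame scan: 0 counterexamples, but it survives ONLY through `¬AllInBandInRangeWindow` — on LEGAL one-sided-comb frames the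
column empties at late non-Ready′ levels (colaw4: from level 9, first Ready′ 13) because the w₀-lineage leaves the column SIDEWAYS without landing); not a
proof route; kept as a typed socket for the regime `j ≤ R/(2σ_max)`. The door of record is `LineageLawQ` (§3). -/
def ColumnLawQ : Prop :=
  ∀ (η : ℝ) (f : ℂ → ℂ) (x₀ s hmax R Hs : ℝ) (B : ℕ), EngineHyps5 2 η f x₀ s hmax R Hs B → ∀ (j : ℕ) (v : ℂ),
    IsLowest StTrkDQ η f x₀ s hmax R Hs B j v → ¬ ReadyR2 η f x₀ s hmax R Hs B j v →
    ¬ AllInBandInRangeWindow f x₀ R Hs j v → ¬ Dimple f j v →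
    ∃ u : ℂ, iteratedDeriv (j + 1) f u = 0 ∧ 0 < u.im ∧ |u.re - x₀| ≤ R / 2

/-- ★ `ColumnLawQ → AntiEscape` (PROVED, by column immunity). -/
theorem antiEscape_of_columnLaw (h : ColumnLawQ) : AntiEscape := by
  intro η f x₀ s hmax R Hs B hE j v hlow hnr hnw hnd
  obtain ⟨u, hu, hup, hcol⟩ := h η f x₀ s hmax R Hs B hE j v hlow hnr hnw hnd
  exact ⟨u, stTrkDQ_succ_of_column hE hlow.1 hu hup hcol⟩

/-- ★ STUB 1 from the column law: `ColumnLawQ → RestSuccBotQ`. -/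
theorem restSuccBotQ_of_columnLaw (h : ColumnLawQ) : RestSuccBotQ :=
  restSuccBotQ_of_antiEscape (antiEscape_of_columnLaw h)

/-! ## §2 COLUMN WINDOWS: a Jensen window inside the column needs NO band bookkeeping -/

/-- `RealEntireLt2 f` from a legal frame. -/
theorem realEntireLt2_of_hyps {η : ℝ} {f : ℂ → ℂ} {x₀ s hmax R Hs : ℝ} {B : ℕ} (hE : EngineHyps5 2 η f x₀ s hmax R Hs B) :
    RealEntireLt2 f := by
  refine { diff := hE.1, real := hE.2.1, growth := ?_ }
  obtain ⟨A', B', ρ, hρ, hgr⟩ := hE.2.2.1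
  obtain ⟨τ, C', hτ0, hτ2, _, hgr'⟩ := StubAnalyticHeredity.growth_treeForm hE.1 ⟨A', B', ρ, hρ, hgr⟩
  exact ⟨τ, C', hτ0, hτ2, hgr'⟩

/-- ★★ COLUMN CLUSTER STEP: a Jensen `Window` of `f^{(j)}` around a band state `v` whose base `[α, β]` lies INSIDE THE COLUMN yields either a
level-`(j+1)` band state (ANY upper zero of `f^{(j+1)}` in the box — in band by column immunity, no «all-in-band» clause, no nesting) or an NL event on
the base (in range automatically). This is `band_successor_or_nlEvent_of_window` (#1032) with `hband` replaced by (E1). -/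
theorem column_successor_or_nlEvent_of_window {η : ℝ} {f : ℂ → ℂ} {x₀ s hmax R Hs : ℝ} {B j : ℕ} {v : ℂ}
    (hE : EngineHyps5 2 η f x₀ s hmax R Hs B) (hv : StTrkDQ η f x₀ s hmax R Hs B j v)
    {α β h : ℝ} (hW : Window (iteratedDeriv j f) α β h) (hvmem : v ∈ Ioo α β ×ℂ Ioo (-h) h)
    (hα : x₀ - R / 2 ≤ α) (hβ : β ≤ x₀ + R / 2) :
    (∃ w : ℂ, w ∈ Ioo α β ×ℂ Ioo (-h) h ∧ StTrkDQ η f x₀ s hmax R Hs B (j + 1) w) ∨ (∃ c ∈ Ioo α β, NLEventOf f j c) := by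
  have hf : RealEntireLt2 f := realEntireLt2_of_hyps hE
  have hGne : iteratedDeriv j f ≠ 0 := hv.1
  set G : ℂ → ℂ := iteratedDeriv j f with hGdef
  have hG : RealEntireLt2 G :=
    { diff := differentiable_iteratedDeriv_of_entire hf.diff j
      growth := by
        obtain ⟨ρ, C, hρ0, hρ, hgr⟩ := hf.growth
        obtain ⟨ρ', C', h1, h2, h3⟩ := exists_growth_iteratedDeriv hf.diff hρ0 hρ hgr j
        exact ⟨ρ', C', h1, h2, h3⟩
      real := im_iteratedDeriv_ofReal hf.diff hf.real j }
  have e1 : deriv G = iteratedDeriv (j + 1) f := by rw [hGdef, ← iteratedDeriv_succ]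
  by_cases hB : LocalB G α β
  swap
  · exact Or.inr (nlEventOf_of_not_localB hf j hB)
  by_cases hA : LocalA G α β h
  · exfalso
    exact (ne_of_gt hv.2.2.1) (no_nonreal_zero_of_localA_localB hG hW hA hB v hvmem hv.2.1)
  left
  unfold LocalA at hA
  push Not at hA
  obtain ⟨ρ, hρ, hdρ, hρim⟩ := hA
  have hdreal : ∀ x : ℝ, (deriv G x).im = 0 := im_deriv_ofReal hG.diff hG.real
  obtain ⟨w, hw, hdw, hwpos⟩ : ∃ w ∈ Ioo α β ×ℂ Ioo (-h) h, deriv G w = 0 ∧ 0 < w.im := by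
    rcases lt_or_gt_of_ne hρim with hneg | hpos
    · refine ⟨conj ρ, ?_, ?_, ?_⟩
      · rw [mem_reProdIm] at hρ ⊢
        obtain ⟨h1, h2, h3⟩ := hρ
        refine ⟨by simpa using h1, ?_, ?_⟩
        · simp only [Complex.conj_im]; linarith [h3]
        · simp only [Complex.conj_im]; linarith [h2]
      · rw [apply_conj_eq_conj (differentiable_deriv hG.diff) hdreal ρ, hdρ, map_zero]
      · simpa using hneg
    · exact ⟨ρ, hρ, hdρ, hpos⟩
  have hfw : iteratedDeriv (j + 1) f w = 0 := by rw [← e1]; exact hdw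
  have hwre : w.re ∈ Ioo α β := (mem_reProdIm.mp hw).1
  have hcol : |w.re - x₀| ≤ R / 2 := by
    rw [abs_le]; constructor <;> linarith [hwre.1, hwre.2]
  exact ⟨w, hw, stTrkDQ_succ_of_column hE hv hfw hwpos hcol⟩

/-- A COLUMN WINDOW around `v` at level `j`: a Jensen `Window` of `f^{(j)}` containing `v`, base inside the column `[x₀ − R/2, x₀ + R/2]`. -/
def ColumnWindow (f : ℂ → ℂ) (x₀ R : ℝ) (j : ℕ) (v : ℂ) : Prop :=
  ∃ (α β h : ℝ), Window (iteratedDeriv j f) α β h ∧ v ∈ Ioo α β ×ℂ Ioo (-h) h ∧ x₀ - R / 2 ≤ α ∧ β ≤ x₀ + R / 2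

/-- ★★ COLUMN WINDOW CASE of STUB 1: a column window around a band state and NO successor ⇒ Ready′ (the NL event on the base is in range because the column
is: `R/2 < (j+3)R/2`). Compare `readyR2_of_window_noSucc` (#1034), which needs the all-in-band clause. -/
theorem readyR2_of_columnWindow_noSucc {η : ℝ} {f : ℂ → ℂ} {x₀ s hmax R Hs : ℝ} {B j : ℕ} {v : ℂ}
    (hE : EngineHyps5 2 η f x₀ s hmax R Hs B) (hv : StTrkDQ η f x₀ s hmax R Hs B j v)
    (hempty : ∀ u' : ℂ, ¬ StTrkDQ η f x₀ s hmax R Hs B (j + 1) u') (hW : ColumnWindow f x₀ R j v) (u : ℂ) :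
    RhW08.StSwap.ReadyR2 η f x₀ s hmax R Hs B j u := by
  obtain ⟨α, β, h, hWin, hvmem, hα, hβ⟩ := hW
  rcases column_successor_or_nlEvent_of_window hE hv hWin hvmem hα hβ with ⟨w, -, hw⟩ | ⟨c, hc, hNL⟩
  · exact absurd hw (hempty w)
  · have hR : 0 < R := by
      have h1 : 0 < s := hE.2.2.2.1
      have h2 : 2 * s ≤ hmax := hE.2.2.2.2.1
      have h3 : 3 * hmax < R := hE.2.2.2.2.2.2.1
      linarith
    have htilt : RhW08.StSwap.TiltReady η f x₀ s hmax R Hs B j u := by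
      refine ⟨c, ?_, hNL⟩
      have hj : (0 : ℝ) ≤ (j : ℝ) := by positivity
      rw [abs_lt]; constructor <;> nlinarith [hc.1, hc.2]
    exact RhIdea6.G20.W07C12.Frac.cumReady_of_ready (Ready := RhW08.StSwap.WinOrTilt) (Or.inr htilt)

/-- `WindowCaseSig ColumnWindow'` for the window-generic STUB-1 assembly `restSuccBotQ_of_piecesG` (#1035), with the predicate in its `(f x₀ R Hs j v)` shape. -/
def ColumnWindow' (f : ℂ → ℂ) (x₀ R _Hs : ℝ) (j : ℕ) (v : ℂ) : Prop := ColumnWindow f x₀ R j v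

/-- `ColumnWindow'` satisfies `WindowCaseSig`: a column-window at level `j` implies `ReadyR2 j+1`. -/
theorem windowCaseSig_columnWindow : WindowCaseSig ColumnWindow' := by
  intro η f x₀ s hmax R Hs B hE j v hv hempty hW
  exact readyR2_of_columnWindow_noSucc hE hv hempty hW v

/-- ★ STUB 1 from the dimple lemma (✔ `dimpleSig_holds`) and the anti-escape residual WITHOUT column windows:
`AntiEscapeG ColumnWindow' → RestSuccBotQ` — the residual may now assume «no Jensen window around the lowest state fits inside the column». -/
theorem restSuccBotQ_of_noColumnWindow (hA : AntiEscapeG ColumnWindow') : RestSuccBotQ :=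
  restSuccBotQ_of_piecesG windowCaseSig_columnWindow dimpleSig_holds hA

/-! ## §2b ENTRY to `ColumnWindow` from SHADOW data: two clear abscissae in the column bracketing `v` suffice (the top is free by the strip) -/

/-- A vertical line `Re = α` is Jensen-clear off the real axis as soon as `α` lies outside the OPEN SHADOW `(Re a − |Im a|, Re a + |Im a|)` of every
non-real zero `a`. -/
theorem jensenClear_vline {G : ℂ → ℂ} {α y : ℝ} (hy0 : y ≠ 0) (hcl : ∀ a : ℂ, G a = 0 → a.im ≠ 0 → |a.im| ≤ |α - a.re|) :
    JensenClear G ((α : ℂ) + (y : ℂ) * I) := by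
  intro a ha hane
  have h1 := hcl a ha hane
  have hre : ((α : ℂ) + (y : ℂ) * I - (a.re : ℂ)).re = α - a.re := by simp
  have him : ((α : ℂ) + (y : ℂ) * I - (a.re : ℂ)).im = y := by simp
  have hnorm : ‖(α : ℂ) + (y : ℂ) * I - (a.re : ℂ)‖ ^ 2 = (α - a.re) ^ 2 + y ^ 2 := by
    rw [Complex.sq_norm, Complex.normSq_apply, hre, him]; ring
  have hy2 : 0 < y ^ 2 := by
    rcases lt_or_gt_of_ne hy0 with h | h <;> nlinarith
  have habs : |α - a.re| ^ 2 = (α - a.re) ^ 2 := sq_abs _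
  have h2 : |α - a.re| < ‖(α : ℂ) + (y : ℂ) * I - (a.re : ℂ)‖ := by
    by_contra hle
    push Not at hle
    have h3 := pow_le_pow_left₀ (norm_nonneg _) hle 2
    rw [hnorm, habs] at h3
    linarith
  exact lt_of_le_of_lt h1 h2

/-- The top side at height `h > Hs` is Jensen-clear for free when all zeros lie in the strip `|Im| ≤ Hs`. -/
theorem jensenClear_top {G : ℂ → ℂ} {x h Hs : ℝ} (hh : Hs < h) (hpos : 0 < h) (hstrip : ∀ a : ℂ, G a = 0 → |a.im| ≤ Hs) :
    JensenClear G ((x : ℂ) + (h : ℂ) * I) := by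
  intro a ha _
  have him : ((x : ℂ) + (h : ℂ) * I - (a.re : ℂ)).im = h := by simp
  calc |a.im| ≤ Hs := hstrip a ha
    _ < h := hh
    _ = |((x : ℂ) + (h : ℂ) * I - (a.re : ℂ)).im| := by rw [him, abs_of_pos hpos]
    _ ≤ ‖(x : ℂ) + (h : ℂ) * I - (a.re : ℂ)‖ := Complex.abs_im_le_norm _

/-- ★★ SHADOW ENTRY (window form): a band state `v` at level `j` and two abscissae `α < Re v < β`, each outside the open shadow of every non-real zero
of `f^{(j)}` and not a zero of `f^{(j)}` or `f^{(j+1)}`, give a Jensen `Window` of height `Hs + 1` containing `v` (the top is clear by analytic heredity). -/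
theorem window_of_clear {η : ℝ} {f : ℂ → ℂ} {x₀ s hmax R Hs : ℝ} {B j : ℕ} {v : ℂ}
    (hE : EngineHyps5 2 η f x₀ s hmax R Hs B) (hv : StTrkDQ η f x₀ s hmax R Hs B j v) {α β : ℝ}
    (hαv : α < v.re) (hvβ : v.re < β)
    (hclα : ∀ a : ℂ, iteratedDeriv j f a = 0 → a.im ≠ 0 → |a.im| ≤ |α - a.re|)
    (hclβ : ∀ a : ℂ, iteratedDeriv j f a = 0 → a.im ≠ 0 → |a.im| ≤ |β - a.re|)
    (hGα : iteratedDeriv j f α ≠ 0) (hGβ : iteratedDeriv j f β ≠ 0)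
    (hdα : iteratedDeriv (j + 1) f α ≠ 0) (hdβ : iteratedDeriv (j + 1) f β ≠ 0) :
    Window (iteratedDeriv j f) α β (Hs + 1) ∧ v ∈ Ioo α β ×ℂ Ioo (-(Hs + 1)) (Hs + 1) := by
  have hHs : 0 ≤ Hs := hE.2.2.2.2.2.2.2.1
  have hstrip : ∀ a : ℂ, iteratedDeriv j f a = 0 → |a.im| ≤ Hs := fun a ha => abs_im_le_of_level hE hv.1 ha
  refine ⟨⟨hαv.trans hvβ, by linarith, ?_, ?_, ?_, hGα, hGβ, ?_, ?_⟩, ?_⟩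
  · exact fun x _ => jensenClear_top (by linarith) (by linarith) hstrip
  · exact fun y _ hy0 => jensenClear_vline hy0 hclα
  · exact fun y _ hy0 => jensenClear_vline hy0 hclβ
  · rw [← iteratedDeriv_succ]; exact hdα
  · rw [← iteratedDeriv_succ]; exact hdβ
  · exact mem_reProdIm.2 ⟨⟨hαv, hvβ⟩, ⟨by linarith [hv.2.2.1], by linarith [hv.2.2.2.2]⟩⟩

/-- ★★ SHADOW ENTRY: the same data with `α, β` INSIDE THE COLUMN give a `ColumnWindow`. Hence the `ColumnWindow` residual reads: on at least one side of
`v`, EVERY column abscissa between `v`'s shadow and the column edge is shadowed (or is one of the finitely many real zeros of `f^{(j)} f^{(j+1)}` there)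
— a DIRTY CHAIN of shadows to the edge. -/
theorem columnWindow_of_clear {η : ℝ} {f : ℂ → ℂ} {x₀ s hmax R Hs : ℝ} {B j : ℕ} {v : ℂ}
    (hE : EngineHyps5 2 η f x₀ s hmax R Hs B) (hv : StTrkDQ η f x₀ s hmax R Hs B j v) {α β : ℝ}
    (hα : x₀ - R / 2 ≤ α) (hαv : α < v.re) (hvβ : v.re < β) (hβ : β ≤ x₀ + R / 2)
    (hclα : ∀ a : ℂ, iteratedDeriv j f a = 0 → a.im ≠ 0 → |a.im| ≤ |α - a.re|)
    (hclβ : ∀ a : ℂ, iteratedDeriv j f a = 0 → a.im ≠ 0 → |a.im| ≤ |β - a.re|)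
    (hGα : iteratedDeriv j f α ≠ 0) (hGβ : iteratedDeriv j f β ≠ 0)
    (hdα : iteratedDeriv (j + 1) f α ≠ 0) (hdβ : iteratedDeriv (j + 1) f β ≠ 0) :
    ColumnWindow f x₀ R j v :=
  have hW := window_of_clear hE hv hαv hvβ hclα hclβ hGα hGβ hdα hdβ
  ⟨α, β, Hs + 1, hW.1, hW.2, hα, hβ⟩

/-- ★★ The column step from shadow data alone: clear abscissae in the column bracketing the band state `v` ⇒ a level-`(j+1)` band state, or an NL event
of level `j` strictly between the two abscissae (in the column, hence in range). -/
theorem column_successor_or_nlEvent_of_clear {η : ℝ} {f : ℂ → ℂ} {x₀ s hmax R Hs : ℝ} {B j : ℕ} {v : ℂ}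
    (hE : EngineHyps5 2 η f x₀ s hmax R Hs B) (hv : StTrkDQ η f x₀ s hmax R Hs B j v) {α β : ℝ}
    (hα : x₀ - R / 2 ≤ α) (hαv : α < v.re) (hvβ : v.re < β) (hβ : β ≤ x₀ + R / 2)
    (hclα : ∀ a : ℂ, iteratedDeriv j f a = 0 → a.im ≠ 0 → |a.im| ≤ |α - a.re|)
    (hclβ : ∀ a : ℂ, iteratedDeriv j f a = 0 → a.im ≠ 0 → |a.im| ≤ |β - a.re|)
    (hGα : iteratedDeriv j f α ≠ 0) (hGβ : iteratedDeriv j f β ≠ 0)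
    (hdα : iteratedDeriv (j + 1) f α ≠ 0) (hdβ : iteratedDeriv (j + 1) f β ≠ 0) :
    (∃ w : ℂ, w ∈ Ioo α β ×ℂ Ioo (-(Hs + 1)) (Hs + 1) ∧ StTrkDQ η f x₀ s hmax R Hs B (j + 1) w) ∨ (∃ c ∈ Ioo α β, NLEventOf f j c) :=
  have hW := window_of_clear hE hv hαv hvβ hclα hclβ hGα hGβ hdα hdβ
  column_successor_or_nlEvent_of_window hE hv hW.1 hW.2 hα hβ


end RhW08.Column
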